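import Summits.CriticalPhenomena.PercolationContinuityZ3.Theorems.PercNearOneGluingNoHeavyQuantThreeRootGateCoupling
import HarnessLib

/-!
# QUANT lane R8, T-DEC: THE THREE-SIBLING GATE STEP FROM THE ORACLE, for outer gates up to an explicit threshold —
# the three-root gate-coupling identity as a seven-component mixture of `GateStepN` oracle instances (census-2 g71)

builds on p205010 (kernel theorem, internal audit signed; external expert review pending)

Support file (`--supports stmt-CriticalPhenomena-4575`), QUANT lane seat prim-quant-census-2 (gen 71); memo
`run/shared/lean/prim/quant/prim-quant-census-2-g71/TIED3-G71.md`.  Theorems only, standard axioms, no sorries.  Sequel of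
`…QuantThreeRootGateCoupling` (the identity `threeRoot_gateCoupling`); the width-3 analogue of arm-1 g45's `sdec_twoRoot_of_opened`, phrased
INSIDE the binder of the lead's node `LawDec.GateStepN` (`…QuantGateStepN`: gate budget `n`, oracle "every `TreeBuiltN` law with `< n`
nontrivial gates is SDEC at its floor"), like `gateStepN_of_tree` / `gateStepN_of_point` of `…QuantGateStepNFree`.

THE THEOREM (`decAt_threeRoot_of_oracle`; `sdecUpTo_threeRoot_of_oracle`).  Opened trees `ρᵢ` tree-built at the common floor `x/p` (`nᵢ` gates,
tops `Mᵢ ≥ 1`, opened means `Rᵢ`), `n₁ + n₂ + n₃ + 3 ≤ n`, a common root gate `p` with `x < p < 1` and `p ≥ 1/2`, an outer gate `0 < a ≤ 1` with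
  (β)  `3ap(1−p)² ≤ p²(1−ap)`        and        (g)  `ap·(R₁+R₂+R₃) ≤ R_j + R_k` for the three pairs.
Then `gate_a(gate_p ρ₁ ∗ gate_p ρ₂ ∗ gate_p ρ₃)` is DEC(j) at floor `a·x` at EVERY layer `j`; hence the three-sibling forest is `SDECUpTo x a₀` for every
`a₀ ≤ 1` satisfying (β), (g) (both are linear in `a`).  PROOF: by `threeRoot_gateCoupling` the gated law is the mixture, with weights
`αλ₁, αλ₂, αλ₃, β, γ′, γ′, γ′` (`λᵢ = (R_j+R_k)/(2ΣR)`), of `gate_{gᵢ}(ρ_j ∗ ρ_k)` (`gᵢ = S/(R_j+R_k)`, tree `i` absent), `gate_{ap}(ρ₁∗ρ₂∗ρ₃)` and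
`gate_{ap}ρᵢ ∗ gate_{ap}(ρ_j∗ρ_k)`; each is `TreeBuiltN` with `≤ n₁+n₂+n₃+2 < n` gates at a floor `≥ a·x`, hence SDEC by the oracle, hence DEC at
`(a·x, its own mean)` at every layer (`decAtT_of_oracle`: `decAt_of_sdec`, `decAt_mono_floor`, `decAtT_mono_top`); every mean is EXACTLY the target
`S = ap·ΣR`; conclude with `decAtT_finite_mixture`.

SCOPE (honest).  The range is never all of `(0,1]`: at `a = 1` (β) needs `p ≥ 3/4` while (g) needs `p·ΣR ≤ min(R_j+R_k)` (`p ≤ 2/3` for equal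
subtrees) — so this is NOT the `GateStepN` instance "two tied trees beside a third", only its small-outer-gate part
(`a ≤ min(p/(p² + 3(1−p)²), min (R_j+R_k)/(p ΣR))`, e.g. `a ≤ 1/2` at `p = 1/2`, `a ≤ .92` at `p = 7/10`, `a ≤ .74` at `p = 9/10` for equal subtrees); larger outer gates have LP
certificates only (README V400; census memo TIED3-G71.md gives the exact coverage map).  `GateStepN`, `GateStepNCore`, `FarTreeRow` remain OPEN; RATE
class (log\*) and the honest sentence of `run/shared/lean/prim/quant/README.md` unchanged.  [this work]; `GateStepN`/`TreeBuiltN`: lead g42;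
SDEC: census-2 g53; `decAtT_finite_mixture`: this lane.  Nothing here is a published result.  The gluing rows served
[cite: KozmaNitzan2024, Conjecture 3 (p. 15)]; product measure [cite: Grimmett1999, §1.3 p. 10].
-/

noncomputable section

namespace Summit.CriticalPhenomena.PercolationContinuityZ3.Theorems

namespace Quant

open Finset

namespace LawDec

/-! ### Oracle instances (inside `GateStepN`'s binder) -/

/-- gating a tree-built law by `0 < q ≤ 1` keeps it tree-built, with at most one more nontrivial gate (`q = 1`: none). [this work] -/
theorem exists_gate_of_treeBuiltN {z : ℝ} {n N : ℕ} {ν : ℕ → ℝ} (hν : TreeBuiltN z n N ν) (q : ℝ) (hq0 : 0 < q)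
    (hq1 : q ≤ 1) :
    ∃ n', n' ≤ n + 1 ∧ TreeBuiltN (q * z) n' N (gate ν q) := by
  rcases eq_or_lt_of_le hq1 with h | h
  · subst h
    refine ⟨n, by omega, ?_⟩
    rw [gate_one, one_mul]
    exact hν
  · exact ⟨n + 1, le_rfl, TreeBuiltN.gate q hq0 h hν⟩

/-- **an oracle instance is DEC at its own mean** at every layer, at every floor `w ≤` its floor and on every top `≥` its top:
the oracle gives SDEC, `decAt_of_sdec` all layers, `decAt_mono_floor` and `decAtT_mono_top` the rest. [this work] -/
theorem decAtT_of_oracle (n : ℕ)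
    (hO : ∀ (x' : ℝ) (n' M' : ℕ) (μ' : ℕ → ℝ), n' < n → TreeBuiltN x' n' M' μ' → SDEC x' M' μ')
    {z : ℝ} {n' N : ℕ} {ν : ℕ → ℝ} (hν : TreeBuiltN z n' N ν) (hn' : n' < n) {w : ℝ} (hwz : w ≤ z) (M : ℕ) (hNM : N ≤ M)
    (j : ℕ) : DECAtT w (∑ h ∈ Finset.range (N + 1), (h : ℝ) * ν h) j M ν := by
  obtain ⟨hz0, hz1, ν0, νN, ν1, νta⟩ := hν.lawFacts
  have d : DECAt z j N ν := decAt_of_sdec (hO z n' N ν hn' hν) hz0 hz1 ν0 νN ν1 νta j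
  have d' := decAt_mono_floor hwz hz1 d
  rw [decAt_iff_decAtT] at d'
  exact decAtT_mono_top d' hNM

/-- **the re-gated pair component is an oracle instance at the target**: for tree-built `ρa`, `ρb` at floor `y` (means `Ra`, `Rb`,
`Ra + Rb > 0`, `na + nb + 1 < n` gates) and a target `0 < S ≤ Ra + Rb`, the law `gate_{S/(Ra+Rb)}(ρa ∗ ρb)` has mean `S` and is DEC at
`(w, S)` at every layer on every top `M ≥ Na + Nb`, for every floor `w` with `w·(Ra + Rb) ≤ S·y`. [this work] -/
theorem decAtT_gate_pair_of_oracle (n : ℕ)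
    (hO : ∀ (x' : ℝ) (n' M' : ℕ) (μ' : ℕ → ℝ), n' < n → TreeBuiltN x' n' M' μ' → SDEC x' M' μ')
    {y : ℝ} {na nb Na Nb : ℕ} {ρa ρb : ℕ → ℝ} (ha : TreeBuiltN y na Na ρa) (hb : TreeBuiltN y nb Nb ρb)
    (hn : na + nb + 1 < n) (S w : ℝ) (hS0 : 0 < S)
    (hR0 : 0 < (∑ h ∈ Finset.range (Na + 1), (h : ℝ) * ρa h) + (∑ h ∈ Finset.range (Nb + 1), (h : ℝ) * ρb h))
    (hSR : S ≤ (∑ h ∈ Finset.range (Na + 1), (h : ℝ) * ρa h) + (∑ h ∈ Finset.range (Nb + 1), (h : ℝ) * ρb h))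
    (hw : w * ((∑ h ∈ Finset.range (Na + 1), (h : ℝ) * ρa h) + (∑ h ∈ Finset.range (Nb + 1), (h : ℝ) * ρb h)) ≤ S * y)
    (M : ℕ) (hM : Na + Nb ≤ M) (j : ℕ) :
    DECAtT w S j M (gate (lconv Na Nb ρa ρb)
      (S / ((∑ h ∈ Finset.range (Na + 1), (h : ℝ) * ρa h) + (∑ h ∈ Finset.range (Nb + 1), (h : ℝ) * ρb h)))) := by
  set R : ℝ := (∑ h ∈ Finset.range (Na + 1), (h : ℝ) * ρa h) + (∑ h ∈ Finset.range (Nb + 1), (h : ℝ) * ρb h) with hR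
  obtain ⟨_, _, _, _, a1, _⟩ := ha.lawFacts
  obtain ⟨_, _, _, _, b1, _⟩ := hb.lawFacts
  have hg0 : 0 < S / R := div_pos hS0 hR0
  have hg1 : S / R ≤ 1 := by rw [div_le_one hR0]; exact hSR
  obtain ⟨n', hn', hg⟩ := exists_gate_of_treeBuiltN (TreeBuiltN.conv ha hb) (S / R) hg0 hg1
  have hwz : w ≤ S / R * y := by
    rw [div_mul_eq_mul_div, le_div_iff₀ hR0]
    exact hw
  have d := decAtT_of_oracle n hO hg (by omega) hwz M hM j
  rw [sum_mul_gate, sum_mul_lconv Na Nb ρa ρb a1 b1, ← hR, div_mul_cancel₀ S hR0.ne'] at d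
  exact d

/-! ### The DEC consequence: three siblings with a common root gate, outer gates up to the threshold -/

/-- **THE THREE-SIBLING GATE STEP FOR SMALL-ENOUGH OUTER GATES, FROM THE ORACLE.**  Inside the binder of `LawDec.GateStepN` (gate budget `n`,
oracle `hO`): opened trees `ρᵢ` tree-built at the common floor `x/p` with `nᵢ` gates and tops `Mᵢ ≥ 1`, `n₁ + n₂ + n₃ + 3 ≤ n`, a common
root gate `p` with `x < p < 1`, `p ≥ 1/2`, and an outer gate `0 < a ≤ 1` with `3ap(1−p)² ≤ p²(1−ap)` and `ap·(R₁+R₂+R₃) ≤ R_j + R_k` for the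
three pairs (`Rᵢ` the opened means).  Then `gate_a(gate_p ρ₁ ∗ gate_p ρ₂ ∗ gate_p ρ₃)` is DEC(j) at floor `a·x` at every layer `j` — by
`threeRoot_gateCoupling` it is a seven-component mixture at the common target `ap·ΣR` of oracle instances (each with `≤ n₁+n₂+n₃+2` gates,
floor `≥ a·x`). [this work] -/
theorem decAt_threeRoot_of_oracle (n : ℕ) (x p a : ℝ) (n₁ n₂ n₃ M₁ M₂ M₃ : ℕ) (ρ₁ ρ₂ ρ₃ : ℕ → ℝ)
    (hO : ∀ (x' : ℝ) (n' M' : ℕ) (μ' : ℕ → ℝ), n' < n → TreeBuiltN x' n' M' μ' → SDEC x' M' μ')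
    (hn : n₁ + n₂ + n₃ + 3 ≤ n) (hx0 : 0 < x) (hxp : x < p) (hp1 : p < 1) (hp2 : 1 / 2 ≤ p)
    (hM₁ : 0 < M₁) (hM₂ : 0 < M₂) (hM₃ : 0 < M₃)
    (hρ₁ : TreeBuiltN (x / p) n₁ M₁ ρ₁) (hρ₂ : TreeBuiltN (x / p) n₂ M₂ ρ₂) (hρ₃ : TreeBuiltN (x / p) n₃ M₃ ρ₃)
    (ha0 : 0 < a) (ha1 : a ≤ 1) (hβ : 3 * (a * p) * (1 - p) ^ 2 ≤ p ^ 2 * (1 - a * p))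
    (h₂₃ : a * p * ((∑ h ∈ Finset.range (M₁ + 1), (h : ℝ) * ρ₁ h) + (∑ h ∈ Finset.range (M₂ + 1), (h : ℝ) * ρ₂ h)
        + (∑ h ∈ Finset.range (M₃ + 1), (h : ℝ) * ρ₃ h))
      ≤ (∑ h ∈ Finset.range (M₂ + 1), (h : ℝ) * ρ₂ h) + (∑ h ∈ Finset.range (M₃ + 1), (h : ℝ) * ρ₃ h))
    (h₁₃ : a * p * ((∑ h ∈ Finset.range (M₁ + 1), (h : ℝ) * ρ₁ h) + (∑ h ∈ Finset.range (M₂ + 1), (h : ℝ) * ρ₂ h)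
        + (∑ h ∈ Finset.range (M₃ + 1), (h : ℝ) * ρ₃ h))
      ≤ (∑ h ∈ Finset.range (M₁ + 1), (h : ℝ) * ρ₁ h) + (∑ h ∈ Finset.range (M₃ + 1), (h : ℝ) * ρ₃ h))
    (h₁₂ : a * p * ((∑ h ∈ Finset.range (M₁ + 1), (h : ℝ) * ρ₁ h) + (∑ h ∈ Finset.range (M₂ + 1), (h : ℝ) * ρ₂ h)
        + (∑ h ∈ Finset.range (M₃ + 1), (h : ℝ) * ρ₃ h))
      ≤ (∑ h ∈ Finset.range (M₁ + 1), (h : ℝ) * ρ₁ h) + (∑ h ∈ Finset.range (M₂ + 1), (h : ℝ) * ρ₂ h))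
    (j : ℕ) :
    DECAt (a * x) j (M₁ + M₂ + M₃) (gate (lconv (M₁ + M₂) M₃ (lconv M₁ M₂ (gate ρ₁ p) (gate ρ₂ p)) (gate ρ₃ p)) a) := by
  -- the opened means and the target
  set R₁ : ℝ := ∑ h ∈ Finset.range (M₁ + 1), (h : ℝ) * ρ₁ h with hR₁
  set R₂ : ℝ := ∑ h ∈ Finset.range (M₂ + 1), (h : ℝ) * ρ₂ h with hR₂
  set R₃ : ℝ := ∑ h ∈ Finset.range (M₃ + 1), (h : ℝ) * ρ₃ h with hR₃
  have hp0 : 0 < p := lt_trans hx0 hxp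
  have hy0 : 0 < x / p := div_pos hx0 hp0
  obtain ⟨_, _, r₁0, r₁M, r₁1, r₁ta⟩ := hρ₁.lawFacts
  obtain ⟨_, _, r₂0, r₂M, r₂1, r₂ta⟩ := hρ₂.lawFacts
  obtain ⟨_, _, r₃0, r₃M, r₃1, r₃ta⟩ := hρ₃.lawFacts
  have hR₁0 : 0 < R₁ :=
    lt_of_lt_of_le (mul_pos hy0 (by exact_mod_cast hM₁)) r₁ta
  have hR₂0 : 0 < R₂ :=
    lt_of_lt_of_le (mul_pos hy0 (by exact_mod_cast hM₂)) r₂ta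
  have hR₃0 : 0 < R₃ :=
    lt_of_lt_of_le (mul_pos hy0 (by exact_mod_cast hM₃)) r₃ta
  set s : ℝ := a * p with hs
  have hs0 : 0 < s := mul_pos ha0 hp0
  have hs1 : s < 1 := by
    rw [hs]
    exact lt_of_le_of_lt (mul_le_of_le_one_left hp0.le ha1) hp1
  have hs1' : (1 : ℝ) - s ≠ 0 := sub_ne_zero.2 (ne_of_gt hs1)
  set Rs : ℝ := R₁ + R₂ + R₃ with hRs
  have hRs0 : 0 < Rs := add_pos (add_pos hR₁0 hR₂0) hR₃0
  have hR₂₃ : R₂ + R₃ ≠ 0 := (add_pos hR₂0 hR₃0).ne'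
  have hR₁₃ : R₁ + R₃ ≠ 0 := (add_pos hR₁0 hR₃0).ne'
  have hR₁₂ : R₁ + R₂ ≠ 0 := (add_pos hR₁0 hR₂0).ne'
  set S : ℝ := s * Rs with hS
  have hS0 : 0 < S := mul_pos hs0 hRs0
  have esx : s * (x / p) = a * x := by rw [hs]; field_simp
  -- the sub-forests at floor `x/p`
  have t₁₂ := TreeBuiltN.conv hρ₁ hρ₂
  have t₁₃ := TreeBuiltN.conv hρ₁ hρ₃
  have t₂₃ := TreeBuiltN.conv hρ₂ hρ₃
  have t₁₂₃ := TreeBuiltN.conv t₁₂ hρ₃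
  obtain ⟨_, _, l₁₂0, l₁₂M, l₁₂1, _⟩ := t₁₂.lawFacts
  obtain ⟨_, _, l₁₃0, l₁₃M, l₁₃1, _⟩ := t₁₃.lawFacts
  obtain ⟨_, _, l₂₃0, l₂₃M, l₂₃1, _⟩ := t₂₃.lawFacts
  -- B: all three opened under the gate `s`
  obtain ⟨nB, hnB, hB⟩ := exists_gate_of_treeBuiltN t₁₂₃ s hs0 hs1.le
  have dB : DECAtT (a * x) S j (M₁ + M₂ + M₃) (gate (lconv (M₁ + M₂) M₃ (lconv M₁ M₂ ρ₁ ρ₂) ρ₃) s) := by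
    have d := decAtT_of_oracle n hO hB (by omega) (le_of_eq esx.symm) (M₁ + M₂ + M₃) le_rfl j
    rw [sum_mul_gate, sum_mul_lconv (M₁ + M₂) M₃ _ _ l₁₂1 r₃1, sum_mul_lconv M₁ M₂ ρ₁ ρ₂ r₁1 r₂1,
      ← hR₁, ← hR₂, ← hR₃, ← hRs, ← hS] at d
    exact d
  -- C components: one sibling gated alone beside the gated pair
  obtain ⟨nc₁, hnc₁, hc₁⟩ := exists_gate_of_treeBuiltN hρ₁ s hs0 hs1.le
  obtain ⟨nc₂, hnc₂, hc₂⟩ := exists_gate_of_treeBuiltN hρ₂ s hs0 hs1.le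
  obtain ⟨nc₃, hnc₃, hc₃⟩ := exists_gate_of_treeBuiltN hρ₃ s hs0 hs1.le
  obtain ⟨nd₁, hnd₁, hd₁⟩ := exists_gate_of_treeBuiltN t₂₃ s hs0 hs1.le
  obtain ⟨nd₂, hnd₂, hd₂⟩ := exists_gate_of_treeBuiltN t₁₃ s hs0 hs1.le
  obtain ⟨nd₃, hnd₃, hd₃⟩ := exists_gate_of_treeBuiltN t₁₂ s hs0 hs1.le
  obtain ⟨_, _, g₁1⟩ := gate_laws M₁ ρ₁ s hs0.le hs1.le r₁0 r₁M r₁1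
  obtain ⟨_, _, g₂1⟩ := gate_laws M₂ ρ₂ s hs0.le hs1.le r₂0 r₂M r₂1
  obtain ⟨_, _, g₃1⟩ := gate_laws M₃ ρ₃ s hs0.le hs1.le r₃0 r₃M r₃1
  obtain ⟨_, _, e₂₃1⟩ := gate_laws (M₂ + M₃) _ s hs0.le hs1.le l₂₃0 l₂₃M l₂₃1
  obtain ⟨_, _, e₁₃1⟩ := gate_laws (M₁ + M₃) _ s hs0.le hs1.le l₁₃0 l₁₃M l₁₃1
  obtain ⟨_, _, e₁₂1⟩ := gate_laws (M₁ + M₂) _ s hs0.le hs1.le l₁₂0 l₁₂M l₁₂1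
  have dC₁ : DECAtT (a * x) S j (M₁ + M₂ + M₃) (lconv M₁ (M₂ + M₃) (gate ρ₁ s) (gate (lconv M₂ M₃ ρ₂ ρ₃) s)) := by
    have d := decAtT_of_oracle n hO (TreeBuiltN.conv hc₁ hd₁) (by omega) (le_of_eq esx.symm) (M₁ + M₂ + M₃) (by omega) j
    rw [sum_mul_lconv M₁ (M₂ + M₃) _ _ g₁1 e₂₃1, sum_mul_gate, sum_mul_gate, sum_mul_lconv M₂ M₃ ρ₂ ρ₃ r₂1 r₃1,
      ← hR₁, ← hR₂, ← hR₃] at d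
    have e : s * R₁ + s * (R₂ + R₃) = S := by rw [hS, hRs]; ring
    rw [e] at d
    exact d
  have dC₂ : DECAtT (a * x) S j (M₁ + M₂ + M₃) (lconv M₂ (M₁ + M₃) (gate ρ₂ s) (gate (lconv M₁ M₃ ρ₁ ρ₃) s)) := by
    have d := decAtT_of_oracle n hO (TreeBuiltN.conv hc₂ hd₂) (by omega) (le_of_eq esx.symm) (M₁ + M₂ + M₃) (by omega) j
    rw [sum_mul_lconv M₂ (M₁ + M₃) _ _ g₂1 e₁₃1, sum_mul_gate, sum_mul_gate, sum_mul_lconv M₁ M₃ ρ₁ ρ₃ r₁1 r₃1,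
      ← hR₁, ← hR₂, ← hR₃] at d
    have e : s * R₂ + s * (R₁ + R₃) = S := by rw [hS, hRs]; ring
    rw [e] at d
    exact d
  have dC₃ : DECAtT (a * x) S j (M₁ + M₂ + M₃) (lconv (M₁ + M₂) M₃ (gate (lconv M₁ M₂ ρ₁ ρ₂) s) (gate ρ₃ s)) := by
    have d := decAtT_of_oracle n hO (TreeBuiltN.conv hd₃ hc₃) (by omega) (le_of_eq esx.symm) (M₁ + M₂ + M₃) le_rfl j
    rw [sum_mul_lconv (M₁ + M₂) M₃ _ _ e₁₂1 g₃1, sum_mul_gate, sum_mul_gate, sum_mul_lconv M₁ M₂ ρ₁ ρ₂ r₁1 r₂1,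
      ← hR₁, ← hR₂, ← hR₃] at d
    have e : s * (R₁ + R₂) + s * R₃ = S := by rw [hS, hRs]; ring
    rw [e] at d
    exact d
  -- A components: one sibling absent, the pair re-gated to the target
  have hw : ∀ Rp : ℝ, Rp ≤ Rs → a * x * Rp ≤ S * (x / p) := by
    intro Rp hRp
    rw [hS, show s * Rs * (x / p) = (s * (x / p)) * Rs by ring, esx]
    exact mul_le_mul_of_nonneg_left hRp (mul_pos ha0 hx0).le
  have dA₁ : DECAtT (a * x) S j (M₁ + M₂ + M₃) (gate (lconv M₂ M₃ ρ₂ ρ₃) (S / (R₂ + R₃))) :=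
    decAtT_gate_pair_of_oracle n hO hρ₂ hρ₃ (by omega) S (a * x) hS0 (add_pos hR₂0 hR₃0) h₂₃
      (hw (R₂ + R₃) (by rw [hRs]; linarith only [hR₁0])) (M₁ + M₂ + M₃) (by omega) j
  have dA₂ : DECAtT (a * x) S j (M₁ + M₂ + M₃) (gate (lconv M₁ M₃ ρ₁ ρ₃) (S / (R₁ + R₃))) :=
    decAtT_gate_pair_of_oracle n hO hρ₁ hρ₃ (by omega) S (a * x) hS0 (add_pos hR₁0 hR₃0) h₁₃
      (hw (R₁ + R₃) (by rw [hRs]; linarith only [hR₂0])) (M₁ + M₂ + M₃) (by omega) j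
  have dA₃ : DECAtT (a * x) S j (M₁ + M₂ + M₃) (gate (lconv M₁ M₂ ρ₁ ρ₂) (S / (R₁ + R₂))) :=
    decAtT_gate_pair_of_oracle n hO hρ₁ hρ₂ (by omega) S (a * x) hS0 (add_pos hR₁0 hR₂0) h₁₂
      (hw (R₁ + R₂) (by rw [hRs]; linarith only [hR₃0])) (M₁ + M₂ + M₃) (by omega) j
  -- the weights
  set α : ℝ := 2 * (1 - p) * (2 * p - 1) with hα
  set γ' : ℝ := (1 - p) ^ 2 / (1 - s) with hγ'
  set β : ℝ := p ^ 2 - 3 * s * γ' with hβdef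
  set l₁ : ℝ := (R₂ + R₃) / (2 * Rs) with hl₁
  set l₂ : ℝ := (R₁ + R₃) / (2 * Rs) with hl₂
  set l₃ : ℝ := (R₁ + R₂) / (2 * Rs) with hl₃
  have hα0 : 0 ≤ α := by
    rw [hα]
    exact mul_nonneg (mul_nonneg (by norm_num) (sub_nonneg.2 hp1.le)) (by linarith only [hp2])
  have hγ'0 : 0 ≤ γ' := div_nonneg (sq_nonneg _) (sub_nonneg.2 hs1.le)
  have hβ0 : 0 ≤ β := by
    have e : β = (p ^ 2 * (1 - s) - 3 * s * (1 - p) ^ 2) / (1 - s) := by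
      rw [hβdef, hγ']
      field_simp
    rw [e]
    exact div_nonneg (sub_nonneg.2 hβ) (sub_nonneg.2 hs1.le)
  have hl : l₁ + l₂ + l₃ = 1 := by
    rw [hl₁, hl₂, hl₃, ← add_div, ← add_div, div_eq_one_iff_eq (mul_ne_zero two_ne_zero hRs0.ne'), hRs]
    ring
  have hαβγ : α + β + 3 * γ' = 1 := by
    rw [hβdef, hγ', hα]
    field_simp
    ring
  have hl₁0 : 0 ≤ l₁ := by positivity
  have hl₂0 : 0 ≤ l₂ := by positivity
  have hl₃0 : 0 ≤ l₃ := by positivity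
  -- the seven-component mixture
  let w : Fin 7 → ℝ := ![α * l₁, α * l₂, α * l₃, β, γ', γ', γ']
  let ν : Fin 7 → ℕ → ℝ :=
    ![gate (lconv M₂ M₃ ρ₂ ρ₃) (S / (R₂ + R₃)), gate (lconv M₁ M₃ ρ₁ ρ₃) (S / (R₁ + R₃)),
      gate (lconv M₁ M₂ ρ₁ ρ₂) (S / (R₁ + R₂)), gate (lconv (M₁ + M₂) M₃ (lconv M₁ M₂ ρ₁ ρ₂) ρ₃) s,
      lconv M₁ (M₂ + M₃) (gate ρ₁ s) (gate (lconv M₂ M₃ ρ₂ ρ₃) s),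
      lconv M₂ (M₁ + M₃) (gate ρ₂ s) (gate (lconv M₁ M₃ ρ₁ ρ₃) s),
      lconv (M₁ + M₂) M₃ (gate (lconv M₁ M₂ ρ₁ ρ₂) s) (gate ρ₃ s)]
  have hw0 : ∀ i, 0 ≤ w i := by
    have e₁ : 0 ≤ α * l₁ := mul_nonneg hα0 hl₁0
    have e₂ : 0 ≤ α * l₂ := mul_nonneg hα0 hl₂0
    have e₃ : 0 ≤ α * l₃ := mul_nonneg hα0 hl₃0
    intro i
    fin_cases i <;> assumption
  have hw1 : ∑ i, w i = 1 := by
    rw [Fin.sum_univ_seven]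
    show α * l₁ + α * l₂ + α * l₃ + β + γ' + γ' + γ' = 1
    linear_combination α * hl + hαβγ
  have hdec : ∀ i, 0 < w i → DECAtT (a * x) S j (M₁ + M₂ + M₃) (ν i) := by
    intro i _
    fin_cases i <;> assumption
  -- the identity, with the natural `A`-part
  have hA := threeRoot_A_of_weights M₁ M₂ M₃ ρ₁ ρ₂ ρ₃ s l₁ l₂ l₃ (S / (R₂ + R₃)) (S / (R₁ + R₃)) (S / (R₁ + R₂))
    (by rw [hl₁, hS]; field_simp) (by rw [hl₂, hS]; field_simp) (by rw [hl₃, hS]; field_simp) hl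
  have hμ : ∀ h, gate (lconv (M₁ + M₂) M₃ (lconv M₁ M₂ (gate ρ₁ p) (gate ρ₂ p)) (gate ρ₃ p)) a h = ∑ i, w i * ν i h := by
    intro h
    rw [Fin.sum_univ_seven]
    show _ = α * l₁ * gate (lconv M₂ M₃ ρ₂ ρ₃) (S / (R₂ + R₃)) h + α * l₂ * gate (lconv M₁ M₃ ρ₁ ρ₃) (S / (R₁ + R₃)) h
      + α * l₃ * gate (lconv M₁ M₂ ρ₁ ρ₂) (S / (R₁ + R₂)) h
      + β * gate (lconv (M₁ + M₂) M₃ (lconv M₁ M₂ ρ₁ ρ₂) ρ₃) s h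
      + γ' * lconv M₁ (M₂ + M₃) (gate ρ₁ s) (gate (lconv M₂ M₃ ρ₂ ρ₃) s) h
      + γ' * lconv M₂ (M₁ + M₃) (gate ρ₂ s) (gate (lconv M₁ M₃ ρ₁ ρ₃) s) h
      + γ' * lconv (M₁ + M₂) M₃ (gate (lconv M₁ M₂ ρ₁ ρ₂) s) (gate ρ₃ s) h
    rw [threeRoot_gateCoupling M₁ M₂ M₃ ρ₁ ρ₂ ρ₃ _ p a r₁M r₂M r₃M hs1' hA h,
      ← hs, ← hγ', ← hβdef, ← hα]
    ring
  -- the mean of the doubly gated law is the target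
  obtain ⟨_, _, t₁1⟩ := gate_laws M₁ ρ₁ p hp0.le hp1.le r₁0 r₁M r₁1
  obtain ⟨_, _, t₂1⟩ := gate_laws M₂ ρ₂ p hp0.le hp1.le r₂0 r₂M r₂1
  obtain ⟨_, _, t₃1⟩ := gate_laws M₃ ρ₃ p hp0.le hp1.le r₃0 r₃M r₃1
  obtain ⟨_, _, _, _, t₁₂1, _⟩ := (TreeBuiltN.conv (TreeBuiltN.gate p hp0 hp1 hρ₁) (TreeBuiltN.gate p hp0 hp1 hρ₂)).lawFacts
  have hmean : ∑ h ∈ Finset.range (M₁ + M₂ + M₃ + 1),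
      (h : ℝ) * gate (lconv (M₁ + M₂) M₃ (lconv M₁ M₂ (gate ρ₁ p) (gate ρ₂ p)) (gate ρ₃ p)) a h = S := by
    rw [sum_mul_gate, sum_mul_lconv (M₁ + M₂) M₃ _ _ t₁₂1 t₃1, sum_mul_lconv M₁ M₂ _ _ t₁1 t₂1, sum_mul_gate, sum_mul_gate,
      sum_mul_gate, ← hR₁, ← hR₂, ← hR₃, hS, hRs, hs]
    ring
  rw [decAt_iff_decAtT, hmean]
  exact decAtT_finite_mixture (a * x) S j (M₁ + M₂ + M₃) _ w ν hw0 hw1 hμ hdec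


/-- **COROLLARY (`SDECUpTo` form: the three-sibling forest is gate-stably DEC for all outer gates up to the threshold).**  Same binder;
if the two threshold conditions hold at `a₀ ≤ 1` they hold at every `a ≤ a₀` (both are linear in `a`), so
`SDECUpTo x a₀ (M₁+M₂+M₃) (gate_p ρ₁ ∗ gate_p ρ₂ ∗ gate_p ρ₃)`.  With `a₀ = 1` this would be the `GateStepN` instance "two tied trees
beside a third with the same root gate" — but `a₀ = 1` never satisfies both conditions; the explicit range is
`a₀ ≤ min(p/(p² + 3(1−p)²), (R_j+R_k)/(p·ΣR))`. [this work] -/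
theorem sdecUpTo_threeRoot_of_oracle (n : ℕ) (x p a₀ : ℝ) (n₁ n₂ n₃ M₁ M₂ M₃ : ℕ) (ρ₁ ρ₂ ρ₃ : ℕ → ℝ)
    (hO : ∀ (x' : ℝ) (n' M' : ℕ) (μ' : ℕ → ℝ), n' < n → TreeBuiltN x' n' M' μ' → SDEC x' M' μ')
    (hn : n₁ + n₂ + n₃ + 3 ≤ n) (hx0 : 0 < x) (hxp : x < p) (hp1 : p < 1) (hp2 : 1 / 2 ≤ p)
    (hM₁ : 0 < M₁) (hM₂ : 0 < M₂) (hM₃ : 0 < M₃)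
    (hρ₁ : TreeBuiltN (x / p) n₁ M₁ ρ₁) (hρ₂ : TreeBuiltN (x / p) n₂ M₂ ρ₂) (hρ₃ : TreeBuiltN (x / p) n₃ M₃ ρ₃)
    (ha₀1 : a₀ ≤ 1) (hβ : 3 * (a₀ * p) * (1 - p) ^ 2 ≤ p ^ 2 * (1 - a₀ * p))
    (h₂₃ : a₀ * p * ((∑ h ∈ Finset.range (M₁ + 1), (h : ℝ) * ρ₁ h) + (∑ h ∈ Finset.range (M₂ + 1), (h : ℝ) * ρ₂ h)
        + (∑ h ∈ Finset.range (M₃ + 1), (h : ℝ) * ρ₃ h))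
      ≤ (∑ h ∈ Finset.range (M₂ + 1), (h : ℝ) * ρ₂ h) + (∑ h ∈ Finset.range (M₃ + 1), (h : ℝ) * ρ₃ h))
    (h₁₃ : a₀ * p * ((∑ h ∈ Finset.range (M₁ + 1), (h : ℝ) * ρ₁ h) + (∑ h ∈ Finset.range (M₂ + 1), (h : ℝ) * ρ₂ h)
        + (∑ h ∈ Finset.range (M₃ + 1), (h : ℝ) * ρ₃ h))
      ≤ (∑ h ∈ Finset.range (M₁ + 1), (h : ℝ) * ρ₁ h) + (∑ h ∈ Finset.range (M₃ + 1), (h : ℝ) * ρ₃ h))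
    (h₁₂ : a₀ * p * ((∑ h ∈ Finset.range (M₁ + 1), (h : ℝ) * ρ₁ h) + (∑ h ∈ Finset.range (M₂ + 1), (h : ℝ) * ρ₂ h)
        + (∑ h ∈ Finset.range (M₃ + 1), (h : ℝ) * ρ₃ h))
      ≤ (∑ h ∈ Finset.range (M₁ + 1), (h : ℝ) * ρ₁ h) + (∑ h ∈ Finset.range (M₂ + 1), (h : ℝ) * ρ₂ h)) :
    SDECUpTo x a₀ (M₁ + M₂ + M₃) (lconv (M₁ + M₂) M₃ (lconv M₁ M₂ (gate ρ₁ p) (gate ρ₂ p)) (gate ρ₃ p)) := by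
  intro a ha0 haa j _
  set R₁ : ℝ := ∑ h ∈ Finset.range (M₁ + 1), (h : ℝ) * ρ₁ h with hR₁
  set R₂ : ℝ := ∑ h ∈ Finset.range (M₂ + 1), (h : ℝ) * ρ₂ h with hR₂
  set R₃ : ℝ := ∑ h ∈ Finset.range (M₃ + 1), (h : ℝ) * ρ₃ h with hR₃
  have hp0 : 0 < p := lt_trans hx0 hxp
  obtain ⟨_, _, r₁0, _, _, _⟩ := hρ₁.lawFacts
  obtain ⟨_, _, r₂0, _, _, _⟩ := hρ₂.lawFacts
  obtain ⟨_, _, r₃0, _, _, _⟩ := hρ₃.lawFacts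
  have hR₁0 : 0 ≤ R₁ := Finset.sum_nonneg fun h _ => mul_nonneg (Nat.cast_nonneg h) (r₁0 h)
  have hR₂0 : 0 ≤ R₂ := Finset.sum_nonneg fun h _ => mul_nonneg (Nat.cast_nonneg h) (r₂0 h)
  have hR₃0 : 0 ≤ R₃ := Finset.sum_nonneg fun h _ => mul_nonneg (Nat.cast_nonneg h) (r₃0 h)
  have hap : a * p ≤ a₀ * p := mul_le_mul_of_nonneg_right haa hp0.le
  have hapR : a * p * (R₁ + R₂ + R₃) ≤ a₀ * p * (R₁ + R₂ + R₃) :=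
    mul_le_mul_of_nonneg_right hap (add_nonneg (add_nonneg hR₁0 hR₂0) hR₃0)
  refine decAt_threeRoot_of_oracle n x p a n₁ n₂ n₃ M₁ M₂ M₃ ρ₁ ρ₂ ρ₃ hO hn hx0 hxp hp1 hp2 hM₁ hM₂ hM₃ hρ₁ hρ₂ hρ₃
    ha0 (haa.trans ha₀1) ?_ (hapR.trans h₂₃) (hapR.trans h₁₃) (hapR.trans h₁₂) j
  calc 3 * (a * p) * (1 - p) ^ 2 ≤ 3 * (a₀ * p) * (1 - p) ^ 2 :=
        mul_le_mul_of_nonneg_right (mul_le_mul_of_nonneg_left hap (by norm_num)) (sq_nonneg _)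
    _ ≤ p ^ 2 * (1 - a₀ * p) := hβ
    _ ≤ p ^ 2 * (1 - a * p) := mul_le_mul_of_nonneg_left (by linarith) (sq_nonneg _)

end LawDec

end Quant

end Summit.CriticalPhenomena.PercolationContinuityZ3.Theorems
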